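import Summits.NavierStokesRegularity.NavierStokesRegularity.Theorems.ScenarioCensusRowF1EpsilonLiouville
import Summits.NavierStokesRegularity.NavierStokesRegularity.Theorems.ScenarioCensusRowF1StretchedTransfer
import HarnessLib

/-!
# LINE «epsilon-top» port, part 3/4: §4 the transfer — fast points, closed scale-invariant conditions, analytic density, the Lamb weight (transfer lemmas BY NAME)

Re-homed for the scenario census (typer seat ns-census-typer-1 g8; the cells F1qd / F1qa / F1qw / F1ql are MEMBERS OF RECORD «DECIDED IN KERNEL IN FILES» of row F1
since census v1.69 (lead g9 RULING [6]; critic idea-crit-3 g6 PASS; ref ns-census-ref g8 PRE-CHECK ✓ §13.14; lit §21.21); this port makes them TREE-decided):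
VERBATIM PORT of ns-idea-3 LINE 17 «epsilon-top», `pub/ideators/ns-idea-3/lines/epsilon-top/line-epsilon-top.lean` sha16 1627485ff09d51d4 (1185 l., lean check
rc 0, 0 sorry), split for the 400-line rule into `ScenarioCensusRowF1Epsilon` (§1–§2) → `…EpsilonLiouville` (§3) → `…EpsilonTransfer` (§4) → `…EpsilonTop` (§5 +
census KEYS).  Lean text VERBATIM in namespace `…Theorems.ScenarioCensus.EpsilonTop` (the line's `…Cruxes.ScenarioCensusRowF1.EpsilonTopLine` re-homed); port
edits: `@[conjecture]` on the residual `VorticityDefectSlack` (≡ `ScenarioCensus.Row_F1`, OPEN), three one-line docstrings added (gate lint); the import of `Theorems.ClockStretchingLawClockCeilingFarPastVorticityFloor` and the ONE display that uses it (`liouville_qw_of_farPastVorticityFloor`, a second proof of `Liouville_qw` from the tree's far-past vorticity floor) are dropped because that module has no farm build at port time — `liouville_qw_holds` is the line's own proof and stays; the lemmas (and the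
read-out `axialDefect`) the line shares VERBATIM with the landed columnar-top / stretched-top / inviscid-top ports are taken BY NAME (listed below).
Statements untouched.

No census VALUE is moved here (row F1 stays OPEN-WITH-LINE; the members become TREE-decided by name); NS regularity is NOT proved; `Row_F1` is
untouched (zero movement, `vorticityDefectSlack_iff_rowF1`); no summit statement is proved by this file. Lemmas that restate already-landed tree declarations are taken BY NAME (gate lint `dedup.landed`): `norm_sub_inner_smul_le` = `ColumnarTop.norm_sub_inner_smul_le`, `exists_linearIsometryEquiv_map_single_one` = `ColumnarTop.exists_linearIsometryEquiv_map_single_one`, `eq_zero_of_lineInvariant` = `ColumnarTop.eq_zero_of_lineInvariant`, `isOpen_ne_zero` = `ColumnarTop.isOpen_ne_zero`, `curl_zero_field` = `StretchedTop.curl_zero_field`, `typeI_ancient_eq_zero_of_lamb_eq_zero` = `StretchedTop.typeI_ancient_eq_zero_of_lamb_eq_zero`, `lamb_smul` = `StretchedTop.lamb_smul`, `axialDefect` = `ColumnarTop.axialDefect`, `axialDefect_fderiv` = `ColumnarTop.axialDefect_fderiv`, `axialDefect_smul` = `ColumnarTop.axialDefect_smul`, `continuous_axialDefect` = `ColumnarTop.continuous_axialDefect`,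 `tendsto_physicalTime` = `ColumnarTop.tendsto_physicalTime`, `eventually_fast` = `ColumnarTop.eventually_fast`, `sqrt_timeLag` = `StretchedTop.sqrt_timeLag`, `closed_transfer` = `StretchedTop.closed_transfer`, `forall_of_forall_ne_zero` = `StretchedTop.forall_of_forall_ne_zero`, `sing_of_not_bounded` = `InviscidTop.sing_of_not_bounded`.
-/

-- the summit and its single problem share the name `NavierStokesRegularity` (D-0017 nested layout)
set_option linter.dupNamespace false

noncomputable section

open MeasureTheory Set Function Filter TopologicalSpace Metric
open scoped Topology NNReal ENNReal InnerProductSpace RealInnerProductSpace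

namespace Summit.NavierStokesRegularity.NavierStokesRegularity.Theorems.ScenarioCensus.EpsilonTop

open Literature.Analysis Literature.Analysis.FluidPDE
open Summit.NavierStokesRegularity.NavierStokesRegularity.Theorems

/-! ## §4 The transfer: fast points, closed scale-invariant conditions, analytic density, the Lamb weight -/

-- `tendsto_physicalTime`: the line restates the tree's `ColumnarTop.tendsto_physicalTime`; taken BY NAME (gate lint dedup.landed).

-- `sqrt_timeLag`: the line restates the tree's `StretchedTop.sqrt_timeLag`; taken BY NAME (gate lint dedup.landed).

-- `eventually_fast`: the line restates the tree's `ColumnarTop.eventually_fast`; taken BY NAME (gate lint dedup.landed).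

-- `closed_transfer`: the line restates the tree's `StretchedTop.closed_transfer`; taken BY NAME (gate lint dedup.landed).

-- `forall_of_forall_ne_zero`: the line restates the tree's `StretchedTop.forall_of_forall_ne_zero`; taken BY NAME (gate lint dedup.landed).

/-- **Gradient conditions globalise**: a closed condition on `∇W(s, ·)` holding on `{W(s, ·) ≠ 0}` and at
`L = 0` holds everywhere (analytic density on nontrivial slices; `∇W(s, ·) = 0` on trivial ones). -/
theorem gradCond_everywhere {C : ℝ} {W : ℝ → E3 → E3} (hW : IsTypeIAncientMild C W)
    {P : ℝ → (E3 →L[ℝ] E3) → Prop} (hPc : ∀ w : ℝ, IsClosed {L : E3 →L[ℝ] E3 | P w L})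
    (hP0 : ∀ w : ℝ, P w 0) (h : ∀ s < 0, ∀ y, W s y ≠ 0 → P (-s) (fderiv ℝ (W s) y)) :
    ∀ s < 0, ∀ y, P (-s) (fderiv ℝ (W s) y) := by
  intro s hs y
  by_cases hnt : ∃ z, W s z ≠ 0
  · have hS : IsClosed {y : E3 | P (-s) (fderiv ℝ (W s) y)} :=
      (hPc (-s)).preimage ((hW.contDiff_slice hs).continuous_fderiv (by simp))
    exact StretchedTop.forall_of_forall_ne_zero hW hs hS (fun y hy => h s hs y hy) hnt y
  · push Not at hnt
    have h0 : W s = fun _ => (0 : E3) := funext hnt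
    rw [h0, fderiv_const_apply]
    exact hP0 (-s)

/-- **Transfer of the ε-Lamb bound**: under the `M`-normalised package (`α √ν = √β`), an ε-Lamb top at a
subcritical level gives `(−t)^{3/2} ‖ω_W × W‖(t, y) ≤ ε` at every `y` with `W(t, y) ≠ 0`. -/
theorem lambDefect_transfer {T ν ε : ℝ} {u : ℝ → E3 → E3} {x₀ : E3} {α β R : ℝ} {c : ℕ → ℝ}
    {W : ℝ → E3 → E3}
    (hα : 0 < α) (hβ : 0 < β) (hαR : α * R = β) (hαν : α * Real.sqrt ν = Real.sqrt β)
    (hcpos : ∀ j, 0 < c j) (hclim : Tendsto c atTop (𝓝 0))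
    (hpt : ∀ t < 0, ∀ y : E3,
      Tendsto (fun j => (c j * α) • u (T + c j ^ 2 * β * t) (x₀ + (c j * R) • y)) atTop (𝓝 (W t y)))
    (hgrad : ∀ t < 0, ∀ y : E3,
      Tendsto (fun j => (c j * α * (c j * R)) • fderiv ℝ (u (T + c j ^ 2 * β * t)) (x₀ + (c j * R) • y))
        atTop (𝓝 (fderiv ℝ (W t) y)))
    {Λ : ℝ → ℝ} (hΛ : IsSubcriticalLevel T Λ) (hH : HasLambDefectAt T Λ ν ε u) :
    ∀ t < 0, ∀ y, W t y ≠ 0 → (-t) * Real.sqrt (-t) * ‖cross (curl (W t) y) (W t y)‖ ≤ ε := by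
  intro t ht y hne
  have ht' : 0 < -t := neg_pos.2 ht
  set K : ℝ := α / Real.sqrt β with hK
  have hsb : 0 < Real.sqrt β := Real.sqrt_pos.2 hβ
  have hK0 : 0 < K := div_pos hα hsb
  have hsν : Real.sqrt ν ≠ 0 := by
    intro h0; rw [h0, mul_zero] at hαν; exact hsb.ne' hαν.symm
  have hKε : K * (ε * Real.sqrt ν) = ε := by
    rw [hK, ← hαν]
    field_simp
  have h1 := (continuous_lamb.tendsto (fderiv ℝ (W t) y, W t y)).comp
    ((hgrad t ht y).prodMk_nhds (hpt t ht y))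
  have h2 := (h1.norm).const_mul ((-t) * Real.sqrt (-t))
  simp only [Function.comp_def] at h2
  have hlim : Tendsto (fun j => (-t) * Real.sqrt (-t) *
      ‖cross (curlCLM ((c j * α * (c j * R)) • fderiv ℝ (u (T + c j ^ 2 * β * t)) (x₀ + (c j * R) • y)))
        ((c j * α) • u (T + c j ^ 2 * β * t) (x₀ + (c j * R) • y))‖) atTop
      (𝓝 ((-t) * Real.sqrt (-t) * ‖cross (curlCLM (fderiv ℝ (W t) y)) (W t y)‖)) := h2
  rw [← curl_eq_curlCLM] at hlim
  have hfast := ColumnarTop.eventually_fast hα hβ hcpos hclim hpt hΛ ht hne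
  have hτ := ColumnarTop.tendsto_physicalTime (T := T) hβ ht hcpos hclim
  refine le_of_tendsto hlim ?_
  filter_upwards [hfast, hτ.eventually hH] with j hj1 hj2
  have hb := hj2 _ hj1
  rw [StretchedTop.sqrt_timeLag hβ ht hcpos j, show T - (T + c j ^ 2 * β * t) = c j ^ 2 * β * (-t) by ring] at hb
  have hcj : 0 < c j := hcpos j
  have hw3 : 0 < c j * α * (c j * R) * (c j * α) := by
    have hR : 0 < R := by
      have : 0 < α * R := by rw [hαR]; exact hβ
      exact pos_of_mul_pos_right this hα.le
    positivity
  rw [StretchedTop.lamb_smul, norm_smul, Real.norm_eq_abs, abs_of_pos hw3, ← curl_eq_curlCLM]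
  have e2 : ∀ X : ℝ, (-t) * Real.sqrt (-t) * (c j * α * (c j * R) * (c j * α) * X) =
      K * (c j ^ 2 * β * (-t) * (c j * Real.sqrt β * Real.sqrt (-t)) * X) := by
    intro X
    rw [show c j * α * (c j * R) * (c j * α) = c j ^ 3 * α * (α * R) by ring, hαR, hK]
    field_simp
  rw [e2]
  calc K * (c j ^ 2 * β * (-t) * (c j * Real.sqrt β * Real.sqrt (-t)) *
        ‖cross (curl (u (T + c j ^ 2 * β * t)) (x₀ + (c j * R) • y))
          (u (T + c j ^ 2 * β * t) (x₀ + (c j * R) • y))‖)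
      ≤ K * (ε * Real.sqrt ν) := mul_le_mul_of_nonneg_left hb hK0.le
    _ = ε := hKε

end Summit.NavierStokesRegularity.NavierStokesRegularity.Theorems.ScenarioCensus.EpsilonTop

end
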